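import Summits.Ventures.PackingBounds.Configurations.Simplex
import Summits.Ventures.PackingBounds.Configurations.CrossPolytope
import Summits.Ventures.PackingBounds.Energy.CoulombTangentLineAllDimensions
import Summits.Ventures.PackingBounds.Energy.CoulombDimensionThreeOctahedron

/-!
# The Thomson problem for `N = 2, 3, 4, 6` (and `12`): least Coulomb energies, two-sided

Framing: lottery ticket; floor = certified bounds/negative ranges. Venture `PackingBounds` (cell
`pub-packcert`, seat `pub-packcert-energy`) — the **attained side** of the cell's sharp Coulomb
(`|x - y|⁻¹`) LP bounds.

* `coulomb_simplex_isLeast`: for every `n ≥ 3` and `2 ≤ N ≤ n + 1`, the least Coulomb energy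
  `Σ_{x ≠ y} |x - y|⁻¹` (ordered pairs) of `N` unit vectors of `ℝⁿ` is `N (N-1) / √(2N/(N-1))`, attained by
  the regular simplex (`Configurations/Simplex`; lower bound `Energy.coulomb_tangent_energy_ge`). For
  `n = 3` this settles the Thomson problem for `N = 2, 3, 4` (antipodal pair, equilateral triangle,
  regular tetrahedron) as `IsLeast` statements.
* `coulomb_octahedron_isLeast`: the least Coulomb energy of `6` unit vectors of `ℝ³` is `3 + 12√2`, attained
  by the regular octahedron (`Configurations/CrossPolytope` with `n = 3`; lower bound
  `Energy.coulomb_energy_card6_ge_octahedron`).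
* `N = 12` (icosahedron, Andreev 1996) is `Config.Icosahedron.coulomb_isLeast` in `Configurations/Icosahedron`.

These are exactly the LP-sharp cases of the Thomson problem (`N = 5`, Schwartz 2013, is not LP-sharp).

## References
* H. Cohn, A. Kumar, J. Amer. Math. Soc. 20 (2007) 99–148, Thm 1.2, Table 1. [`CohnKumar2006`]
* V. A. Yudin, *Minimum potential energy of a point system of charges*, Discrete Math. Appl. 3 (1993) 75–81. [`Yudin1993`]
-/

namespace Summit.Ventures.PackingBounds.Config.Thomson

open Finset

/-- For unit vectors, `|x - y|⁻¹ = (√(2 - 2⟨x,y⟩))⁻¹`. -/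
private theorem inv_norm_sub_eq {n : ℕ} {x y : EuclideanSpace ℝ (Fin n)} (hx : ‖x‖ = 1) (hy : ‖y‖ = 1) :
    ‖x - y‖⁻¹ = (Real.sqrt (2 - 2 * inner ℝ x y))⁻¹ := by
  have hsq : ‖x - y‖ ^ 2 = 2 - 2 * inner ℝ x y := by
    rw [norm_sub_sq_real, hx, hy]; ring
  rw [← hsq, Real.sqrt_sq (norm_nonneg _)]

/-- The Coulomb energy of a configuration of unit vectors is its `a`-energy for
`a(t) = (√(2 - 2t))⁻¹`. -/
private theorem coulomb_eq_energy {n : ℕ} (C : Finset (EuclideanSpace ℝ (Fin n)))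
    (h1 : ∀ x ∈ C, ‖x‖ = 1) :
    ∑ x ∈ C, ∑ y ∈ C.erase x, ‖x - y‖⁻¹ =
      ∑ x ∈ C, ∑ y ∈ C.erase x, (Real.sqrt (2 - 2 * inner ℝ x y))⁻¹ :=
  Finset.sum_congr rfl fun x hx => Finset.sum_congr rfl fun y hy =>
    inv_norm_sub_eq (h1 x hx) (h1 y (Finset.mem_of_mem_erase hy))

/-- **Least Coulomb energy of `N ≤ n + 1` points on `S^{n-1}` (`n ≥ 3`): the regular simplex.** The least
value of `Σ_{x ≠ y} |x - y|⁻¹` over `N`-point configurations of unit vectors of `ℝⁿ`, `2 ≤ N ≤ n + 1`, is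
`N (N-1) (√(2N/(N-1)))⁻¹`. For `n = 3`: the Thomson problem for `N = 2, 3, 4`.
[cite: CohnKumar2006, Theorem 1.2] -/
theorem coulomb_simplex_isLeast {n N : ℕ} (hn : 3 ≤ n) (h2 : 2 ≤ N) (hN : N ≤ n + 1) :
    IsLeast {E : ℝ | ∃ C : Finset (EuclideanSpace ℝ (Fin n)), (∀ x ∈ C, ‖x‖ = 1) ∧ C.card = N ∧
      E = ∑ x ∈ C, ∑ y ∈ C.erase x, ‖x - y‖⁻¹}
      ((N : ℝ) * ((N : ℝ) - 1) * (Real.sqrt (2 * N / ((N : ℝ) - 1)))⁻¹) := by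
  refine ⟨?_, ?_⟩
  · obtain ⟨C, hc, h1, -, he⟩ := Simplex.exists_config (n := n) h2 hN
    refine ⟨C, h1, hc, ?_⟩
    have key := he (fun t => (Real.sqrt (2 - 2 * t))⁻¹)
    beta_reduce at key
    rw [coulomb_eq_energy C h1, key]
    have h2' : (2 : ℝ) ≤ N := by exact_mod_cast h2
    have hN1 : (N : ℝ) - 1 ≠ 0 := by linarith
    have hnode : (2 : ℝ) - 2 * (-1 / ((N : ℝ) - 1)) = 2 * N / ((N : ℝ) - 1) := by
      field_simp
      ring
    simp only [hnode]
    ring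
  · rintro E ⟨C, h1, hcard, rfl⟩
    exact Energy.coulomb_tangent_energy_ge hn N h2 C h1 hcard

/-- **The Thomson problem for `N = 6`: the regular octahedron.** The least Coulomb energy
`Σ_{x ≠ y} |x - y|⁻¹` (ordered pairs) of `6` unit vectors of `ℝ³` is `3 + 12√2`.
[cite: CohnKumar2006, Theorem 1.2] -/
theorem coulomb_octahedron_isLeast :
    IsLeast {E : ℝ | ∃ C : Finset (EuclideanSpace ℝ (Fin 3)), (∀ x ∈ C, ‖x‖ = 1) ∧ C.card = 6 ∧
      E = ∑ x ∈ C, ∑ y ∈ C.erase x, ‖x - y‖⁻¹}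
      (3 + 12 * Real.sqrt 2) := by
  refine ⟨?_, ?_⟩
  · obtain ⟨C, hc, h1, -, he⟩ := CrossPolytope.exists_config 3
    refine ⟨C, h1, by rw [hc], ?_⟩
    have key := he (fun t => (Real.sqrt (2 - 2 * t))⁻¹)
    beta_reduce at key
    rw [coulomb_eq_energy C h1, key]
    have h4 : Real.sqrt (2 - 2 * (-1 : ℝ)) = 2 := by
      rw [show (2 : ℝ) - 2 * (-1) = 2 ^ 2 by norm_num, Real.sqrt_sq (by norm_num)]
    have h0 : Real.sqrt (2 - 2 * (0 : ℝ)) = Real.sqrt 2 := by norm_num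
    have hs : Real.sqrt 2 * Real.sqrt 2 = 2 := Real.mul_self_sqrt (by norm_num)
    have hinv : (Real.sqrt 2)⁻¹ = Real.sqrt 2 / 2 :=
      inv_eq_of_mul_eq_one_right (by rw [mul_div_assoc', hs]; norm_num)
    simp only [h4, h0, hinv]
    push_cast
    ring
  · rintro E ⟨C, h1, hcard, rfl⟩
    exact Energy.coulomb_energy_card6_ge_octahedron C h1 hcard

end Summit.Ventures.PackingBounds.Config.Thomson
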